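import Summits.BirchSwinnertonDyer.BirchSwinnertonDyer.Theorems.Rank2ObservatoryPadicSymbolTable
import Summits.BirchSwinnertonDyer.BirchSwinnertonDyer.Theorems.Rank2Observatory389a1
import Summits.BirchSwinnertonDyer.BirchSwinnertonDyer.Theorems.Rank2Observatory5077a1
import HarnessLib

/-!
# BirchSwinnertonDyer — rank ≥ 2 observatory: the `p`-adic row of 389a1 and 5077a1 (kernel cells)

HONEST FRAMING: per-curve certified theorems and census instruments; no claim on BSD in rank ≥ 2.

Module of the series `Rank2ObservatoryPadic*.lean` (see `Rank2ObservatoryPadicRow.lean` for the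
generic squeeze `padicRow_of_certificate` and its named hypotheses `hPRS`, `hkato`, `hf`, `hlow`, `hLp`).
Here the two showcase curves of the observatory — `389a1` (rank 2, `Rank2Observatory389a1.lean`,
`Curve389a1.E`) and `5077a1` (rank 3, `Rank2Observatory5077a1.lean`, `curve5077a1`) — get their
integer models `e389 = [0,1,1,−2,0]`, `e5077 = [0,0,1,−7,6]`, with every decidable input of the
`p`-adic row checked by the kernel at each good ordinary `p ∈ {5, 7, 11, 13}`, and the row theorems
`padicRow_389a1`, `padicRow_5077a1` (any such `p`) and `padicRow_389a1_5`, `padicRow_5077a1_7` (the two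
cells of record below); the later modules `Rank2ObservatoryPadicSymbolCells389a1/5077a1.lean` replace
their hypothesis `hLp` by the kernel-evaluated Riemann sum of a modular-symbol table.

## Two certified cells in the kernel: `(389a1, p = 5)` (rank 2) and `(5077a1, p = 7)` (rank 3)

Everything Lean can check today IS checked: the integer model is a global minimal equation
(`Δ = 389`, `5077` are prime, so `q¹² ∤ Δ` for every prime `q`), the curve is elliptic, the point
count `#Ẽ(𝔽_p)` by the Euler criterion (`decide +kernel`, as in the tree's 37a1 file of crux
`PAdicOrderThesisR2`), hence `a_p` and good ORDINARY reduction at `p`. What remains named: `hPRS`,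
`hkato`, the newform `hf`, the rank certificate `hlow` (cert seats; the same hypothesis as in
`Rank2Observatory389a1.lean` / `Rank2Observatory5077a1.lean`, transported along
`baseChange_e389_eq` / `baseChange_e5077_eq`) and the `p`-adic cell certificate `hLp`.

DATA (cells of record, `data/padic/DIFF/DIFF_R2A.tsv` fbdaf8ca…, `DIFF_R3A.tsv` 98be7564…):
`389a1, p=5`: `a_5 = −3`, engine A `ord_T L_5 = 2` at level `n = 6` with
`[T²] L_5 ≡ 4 + 4·5 + 5² + 5³ + 4·5⁴ (mod 5⁵)` (a unit; engine-A normalisation by `Ω_E`), engine B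
upper bound `2` at `nL = 8`, `[T²]` agree to `5/5` digits, `v_5(Reg_MST) = 0` both engines (12/12
digits), cell `certified(H+L)` (jobs `j064012`/`j064037`, `j064708`). `5077a1, p=7`: `a_7 = −4`,
`ord_T L_7 = 3` (A, `n = 4`, `[T³] L_7 ≡ 2 + 4·7 + 4·7² (mod 7³)`; B, `nL = 7`), `[T³]` agree `3/3`,
`v_7(Reg_MST) = 0` (12/12), `certified(H+L)` (`j064033`/`j064125`, `j064694`).
-/

-- single-conjunct summit: `Summit.BirchSwinnertonDyer.BirchSwinnertonDyer.…` repeats the name by design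
set_option linter.dupNamespace false

noncomputable section

open scoped Classical

namespace Summit.BirchSwinnertonDyer.BirchSwinnertonDyer.Rank2Observatory

open scoped MatrixGroups ModularForm
open CongruenceSubgroup Literature.NumberTheory.EllipticCurves
  Literature.NumberTheory.EllipticCurves.ModularForms WeierstrassCurve

namespace Cell389a1

/-- The integer model `[0, 1, 1, −2, 0]` of 389a1 (Cremona Table 1). [folklore] -/
def e389 : WeierstrassCurve ℤ := ⟨0, 1, 1, -2, 0⟩

/-- `Δ(389a1) = 389`. [folklore] -/
theorem e389_Δ : e389.Δ = 389 := by
  norm_num [e389, WeierstrassCurve.Δ, WeierstrassCurve.b₂, WeierstrassCurve.b₄, WeierstrassCurve.b₆,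
    WeierstrassCurve.b₈]

/-- The base change of the integer model is the observatory's `Curve389a1.E`. [folklore] -/
theorem baseChange_e389_eq : e389.baseChange ℚ = Curve389a1.E := by
  ext <;> simp [e389, Curve389a1.E, WeierstrassCurve.baseChange]

/-- 389a1 is an elliptic curve (`Δ = 389 ≠ 0`). [folklore] -/
instance isElliptic : (e389.baseChange ℚ).IsElliptic :=
  isElliptic_baseChange_int _ (by rw [e389_Δ]; norm_num)

/-- `[0, 1, 1, −2, 0]` is a global minimal equation (`Δ = 389` prime: `q¹² ∤ 389` for every prime
`q`; Silverman AEC VII.1 Remark 1.1, VIII.8). [cite: SilvermanAEC2009, VII.1 Remark 1.1] -/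
instance isGloballyMinimal : (e389.baseChange ℚ).IsGloballyMinimal :=
  isGloballyMinimal_baseChange_int _ <| forall_not_pow_dvd_or_of_bound _ (B := 2)
    (by rw [e389_Δ]; decide) (by rw [e389_Δ]; decide)
    (fun p hp hprime ↦ absurd hprime (by
      have : p < 2 := Finset.mem_range.mp hp
      interval_cases p <;> decide))

/-- `#Ẽ(𝔽_5) = 9` for 389a1 (kernel point count via the Euler criterion). [folklore] -/
theorem card_e389_5 :
    Nat.card ((e389.map (Int.castRingHom (ZMod 5))).toAffine.Point) = 9 := by
  rw [@WeierstrassCurve.natCard_point_eq_one_add_card (ZMod 5) (@ZMod.instField 5 ⟨by norm_num⟩) _ _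
    _ (by decide +kernel), @card_sol_eq_sum_euler (ZMod 5) (@ZMod.instField 5 ⟨by norm_num⟩) _ _
    (by rw [ZMod.ringChar_zmod_n]; decide), ZMod.card]
  decide +kernel

/-- `a_5(389a1) = −3`. [folklore] -/
theorem frobeniusTrace_e389_5 : frobeniusTrace (e389.baseChange ℚ) 5 = -3 := by
  rw [frobeniusTrace_baseChange_int _ card_e389_5]
  norm_num

/-- `5` is a good ORDINARY prime of 389a1 (`5 ∤ Δ = 389`, `a_5 = −3`). [folklore] -/
theorem isOrdinaryAt_e389_5 : IsOrdinaryAt (e389.baseChange ℚ) 5 := by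
  refine ⟨hasGoodReductionAtPrime_baseChange_int _ 5 ?_, ?_⟩
  · rw [e389_Δ]; norm_num
  · rw [frobeniusTrace_e389_5]; norm_num

/-- `#Ẽ(𝔽_7) = 13` for 389a1 (kernel point count via the Euler criterion). [folklore] -/
theorem card_e389_7 :
    Nat.card ((e389.map (Int.castRingHom (ZMod 7))).toAffine.Point) = 13 := by
  rw [@WeierstrassCurve.natCard_point_eq_one_add_card (ZMod 7) (@ZMod.instField 7 ⟨by norm_num⟩) _ _
    _ (by decide +kernel), @card_sol_eq_sum_euler (ZMod 7) (@ZMod.instField 7 ⟨by norm_num⟩) _ _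
    (by rw [ZMod.ringChar_zmod_n]; decide), ZMod.card]
  decide +kernel

/-- `a_7(389a1) = −5`. [folklore] -/
theorem frobeniusTrace_e389_7 : frobeniusTrace (e389.baseChange ℚ) 7 = -5 := by
  rw [frobeniusTrace_baseChange_int _ card_e389_7]
  norm_num

/-- `7` is a good ORDINARY prime of 389a1 (`7 ∤ Δ = 389`, `a_7 = −5`). [folklore] -/
theorem isOrdinaryAt_e389_7 : IsOrdinaryAt (e389.baseChange ℚ) 7 := by
  refine ⟨hasGoodReductionAtPrime_baseChange_int _ 7 ?_, ?_⟩
  · rw [e389_Δ]; norm_num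
  · rw [frobeniusTrace_e389_7]; norm_num

/-- `#Ẽ(𝔽_11) = 16` for 389a1 (kernel point count via the Euler criterion). [folklore] -/
theorem card_e389_11 :
    Nat.card ((e389.map (Int.castRingHom (ZMod 11))).toAffine.Point) = 16 := by
  rw [@WeierstrassCurve.natCard_point_eq_one_add_card (ZMod 11) (@ZMod.instField 11 ⟨by norm_num⟩) _ _
    _ (by decide +kernel), @card_sol_eq_sum_euler (ZMod 11) (@ZMod.instField 11 ⟨by norm_num⟩) _ _
    (by rw [ZMod.ringChar_zmod_n]; decide), ZMod.card]
  decide +kernel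

/-- `a_11(389a1) = −4`. [folklore] -/
theorem frobeniusTrace_e389_11 : frobeniusTrace (e389.baseChange ℚ) 11 = -4 := by
  rw [frobeniusTrace_baseChange_int _ card_e389_11]
  norm_num

/-- `11` is a good ORDINARY prime of 389a1 (`11 ∤ Δ = 389`, `a_11 = −4`). [folklore] -/
theorem isOrdinaryAt_e389_11 : IsOrdinaryAt (e389.baseChange ℚ) 11 := by
  refine ⟨hasGoodReductionAtPrime_baseChange_int _ 11 ?_, ?_⟩
  · rw [e389_Δ]; norm_num
  · rw [frobeniusTrace_e389_11]; norm_num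

/-- `#Ẽ(𝔽_13) = 17` for 389a1 (kernel point count via the Euler criterion). [folklore] -/
theorem card_e389_13 :
    Nat.card ((e389.map (Int.castRingHom (ZMod 13))).toAffine.Point) = 17 := by
  rw [@WeierstrassCurve.natCard_point_eq_one_add_card (ZMod 13) (@ZMod.instField 13 ⟨by norm_num⟩) _ _
    _ (by decide +kernel), @card_sol_eq_sum_euler (ZMod 13) (@ZMod.instField 13 ⟨by norm_num⟩) _ _
    (by rw [ZMod.ringChar_zmod_n]; decide), ZMod.card]
  decide +kernel

/-- `a_13(389a1) = −3`. [folklore] -/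
theorem frobeniusTrace_e389_13 : frobeniusTrace (e389.baseChange ℚ) 13 = -3 := by
  rw [frobeniusTrace_baseChange_int _ card_e389_13]
  norm_num

/-- `13` is a good ORDINARY prime of 389a1 (`13 ∤ Δ = 389`, `a_13 = −3`). [folklore] -/
theorem isOrdinaryAt_e389_13 : IsOrdinaryAt (e389.baseChange ℚ) 13 := by
  refine ⟨hasGoodReductionAtPrime_baseChange_int _ 13 ?_, ?_⟩
  · rw [e389_Δ]; norm_num
  · rw [frobeniusTrace_e389_13]; norm_num

/-- **The cells `(389a1, p)`, `p ∈ {5, 7, 11, 13}`, of the Schneider / `p`-adic BSD census, in the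
kernel — generic in the good ordinary prime `p ≥ 5`** (per-curve certified theorem; no claim on BSD
in rank ≥ 2). Inputs named: `hPRS` (Perrin-Riou–Schneider, BMS Thm. 1.7), `hkato` (Kato Thm. 17.4 at
`(389a1, p, f)`), `hf` (the newform of 389a1), `hlow : 2 ≤ rank` (cert-1/cert-3 two-engine certificate: `(0,0), (1,0)` independent — hypothesis `rank_lower` of
`Rank2Observatory389a1.lean`),
`hLp : [T²] L_p(f, α_p, T) ≠ 0` (padic-1/padic-2 two-engine cell certificate; or use
`padicRow_of_riemannSum_certificate`). Ordinarity at `p = 5, 7, 11, 13`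
(`isOrdinaryAt_e389_5/7/11/13`), minimality and ellipticity are PROVED. The census cells
(`DIFF_R2A.tsv`, all `certified(H+L)`, `v_p(Reg_MST) = 0` both engines):
* `p = 5`: `a_5 = -3`, engine A `ord_T L_5 = 2` at level `n = 6`, `[T²]` agree with engine B (`nL = 8`) to 5/5 digits, `Ш_5 ≡ 1`; jobs `j064012`/`j064037`, `j064708`;
* `p = 7`: `a_7 = -5`, A: level 5, `[T²]` 4/4 digits, B: agree; `Ш_7 ≡ 1`;
* `p = 11`: `a_11 = -4`, A: level 4, `[T²]` 3/3; `Ш_11 ≡ 1`;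
* `p = 13`: `a_13 = -3`, A: level 4, `[T²]` 3/3; `Ш_13 ≡ 1`;
Output: `rank = 2`, `ord_{T=0} L_p = 2`, `Ш(389a1)[p^∞]` finite, the canonical `p`-adic height of
389a1 is non-degenerate, `corank Sel_{p^∞} = 2`. [cite: BalakrishnanMullerStein2015, Thm. 1.7]
[cite: Kato2004Asterisque, Thm. 17.4 (p. 273)] -/
theorem padicRow_389a1 (p : ℕ) [Fact p.Prime] (h5 : 5 ≤ p)
    (hord : IsOrdinaryAt (e389.baseChange ℚ) p) (hPRS : Schneider1985_order_charGenerator) {N : ℕ} [NeZero N] {f : CuspForm (Gamma0 N) 2}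
    (hf : IsNewformOf (e389.baseChange ℚ) f)
    (hkato : ∀ (κ : ZpExtension ℚ p) (γ : Field.absoluteGaloisGroup ℚ),
      kato_divisibility (e389.baseChange ℚ) p (κ := κ) (γ := γ) (f := f))
    (hlow : 2 ≤ Curve389a1.E.mordellWeilRank)
    (hLp : PowerSeries.coeff 2 (padicLFunction f (unitRoot (e389.baseChange ℚ) p : ℚ_[p])) ≠ 0) :
    Curve389a1.E.mordellWeilRank = 2 ∧
      (padicLFunction f (unitRoot (e389.baseChange ℚ) p : ℚ_[p])).order = 2 ∧
      Finite (AddCommGroup.primaryComponent (e389.baseChange ℚ).sha p) ∧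
      (∀ Dh : PAdicHeightData (e389.baseChange ℚ) p, Dh.IsCanonical → SchneiderConjecture Dh) ∧
      (e389.baseChange ℚ).selmerCorank p = 2 := by
  have hlow' : 2 ≤ (e389.baseChange ℚ).mordellWeilRank := by rw [baseChange_e389_eq]; exact hlow
  obtain ⟨hr, ho, hfin, hS⟩ :=
    padicRow_of_certificate hPRS (e389.baseChange ℚ) p hkato h5 hord hf hlow' hLp
  refine ⟨by rw [← baseChange_e389_eq]; exact hr, ho, hfin, hS, ?_⟩
  exact selmerCorank_eq_of_certificate hPRS (e389.baseChange ℚ) p hkato h5 hord hf hlow' hLp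

/-- The showcase cell `(389a1, p = 5)` (`padicRow_389a1` at `p = 5`, ordinarity discharged by
`isOrdinaryAt_e389_5`). [cite: BalakrishnanMullerStein2015, Thm. 1.7]
[cite: Kato2004Asterisque, Thm. 17.4 (p. 273)] -/
theorem padicRow_389a1_5 (hPRS : Schneider1985_order_charGenerator) {N : ℕ} [NeZero N]
    {f : CuspForm (Gamma0 N) 2} (hf : IsNewformOf (e389.baseChange ℚ) f)
    (hkato : ∀ (κ : ZpExtension ℚ 5) (γ : Field.absoluteGaloisGroup ℚ),
      kato_divisibility (e389.baseChange ℚ) 5 (κ := κ) (γ := γ) (f := f))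
    (hlow : 2 ≤ Curve389a1.E.mordellWeilRank)
    (hLp : PowerSeries.coeff 2 (padicLFunction f (unitRoot (e389.baseChange ℚ) 5 : ℚ_[5])) ≠ 0) :
    Curve389a1.E.mordellWeilRank = 2 ∧
      (padicLFunction f (unitRoot (e389.baseChange ℚ) 5 : ℚ_[5])).order = 2 ∧
      Finite (AddCommGroup.primaryComponent (e389.baseChange ℚ).sha 5) ∧
      (∀ Dh : PAdicHeightData (e389.baseChange ℚ) 5, Dh.IsCanonical → SchneiderConjecture Dh) ∧
      (e389.baseChange ℚ).selmerCorank 5 = 2 :=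
  padicRow_389a1 5 (by norm_num) isOrdinaryAt_e389_5 hPRS hf hkato hlow hLp

end Cell389a1

namespace Cell5077a1

/-- The integer model `[0, 0, 1, −7, 6]` of 5077a1 (Cremona Table 1). [folklore] -/
def e5077 : WeierstrassCurve ℤ := ⟨0, 0, 1, -7, 6⟩

/-- `Δ(5077a1) = 5077`. [folklore] -/
theorem e5077_Δ : e5077.Δ = 5077 := by
  norm_num [e5077, WeierstrassCurve.Δ, WeierstrassCurve.b₂, WeierstrassCurve.b₄, WeierstrassCurve.b₆,
    WeierstrassCurve.b₈]

/-- The base change of the integer model is the observatory's `curve5077a1`. [folklore] -/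
theorem baseChange_e5077_eq : e5077.baseChange ℚ = curve5077a1 := by
  ext <;> simp [e5077, curve5077a1, WeierstrassCurve.baseChange]

/-- 5077a1 is an elliptic curve (`Δ = 5077 ≠ 0`). [folklore] -/
instance isElliptic : (e5077.baseChange ℚ).IsElliptic :=
  isElliptic_baseChange_int _ (by rw [e5077_Δ]; norm_num)

/-- `[0, 0, 1, −7, 6]` is a global minimal equation (`Δ = 5077` prime). [cite: SilvermanAEC2009, VII.1 Remark 1.1] -/
instance isGloballyMinimal : (e5077.baseChange ℚ).IsGloballyMinimal :=
  isGloballyMinimal_baseChange_int _ <| forall_not_pow_dvd_or_of_bound _ (B := 3)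
    (by rw [e5077_Δ]; decide) (by rw [e5077_Δ]; decide)
    (fun p hp hprime ↦ by
      have : p < 3 := Finset.mem_range.mp hp
      interval_cases p
      · exact absurd hprime (by decide)
      · exact absurd hprime (by decide)
      · exact Or.inl (by rw [e5077_Δ]; decide))

/-- `#Ẽ(𝔽_5) = 10` for 5077a1 (kernel point count via the Euler criterion). [folklore] -/
theorem card_e5077_5 :
    Nat.card ((e5077.map (Int.castRingHom (ZMod 5))).toAffine.Point) = 10 := by
  rw [@WeierstrassCurve.natCard_point_eq_one_add_card (ZMod 5) (@ZMod.instField 5 ⟨by norm_num⟩) _ _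
    _ (by decide +kernel), @card_sol_eq_sum_euler (ZMod 5) (@ZMod.instField 5 ⟨by norm_num⟩) _ _
    (by rw [ZMod.ringChar_zmod_n]; decide), ZMod.card]
  decide +kernel

/-- `a_5(5077a1) = −4`. [folklore] -/
theorem frobeniusTrace_e5077_5 : frobeniusTrace (e5077.baseChange ℚ) 5 = -4 := by
  rw [frobeniusTrace_baseChange_int _ card_e5077_5]
  norm_num

/-- `5` is a good ORDINARY prime of 5077a1 (`5 ∤ Δ = 5077`, `a_5 = −4`). [folklore] -/
theorem isOrdinaryAt_e5077_5 : IsOrdinaryAt (e5077.baseChange ℚ) 5 := by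
  refine ⟨hasGoodReductionAtPrime_baseChange_int _ 5 ?_, ?_⟩
  · rw [e5077_Δ]; norm_num
  · rw [frobeniusTrace_e5077_5]; norm_num

/-- `#Ẽ(𝔽_7) = 12` for 5077a1 (kernel point count via the Euler criterion). [folklore] -/
theorem card_e5077_7 :
    Nat.card ((e5077.map (Int.castRingHom (ZMod 7))).toAffine.Point) = 12 := by
  rw [@WeierstrassCurve.natCard_point_eq_one_add_card (ZMod 7) (@ZMod.instField 7 ⟨by norm_num⟩) _ _
    _ (by decide +kernel), @card_sol_eq_sum_euler (ZMod 7) (@ZMod.instField 7 ⟨by norm_num⟩) _ _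
    (by rw [ZMod.ringChar_zmod_n]; decide), ZMod.card]
  decide +kernel

/-- `a_7(5077a1) = −4`. [folklore] -/
theorem frobeniusTrace_e5077_7 : frobeniusTrace (e5077.baseChange ℚ) 7 = -4 := by
  rw [frobeniusTrace_baseChange_int _ card_e5077_7]
  norm_num

/-- `7` is a good ORDINARY prime of 5077a1 (`7 ∤ Δ = 5077`, `a_7 = −4`). [folklore] -/
theorem isOrdinaryAt_e5077_7 : IsOrdinaryAt (e5077.baseChange ℚ) 7 := by
  refine ⟨hasGoodReductionAtPrime_baseChange_int _ 7 ?_, ?_⟩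
  · rw [e5077_Δ]; norm_num
  · rw [frobeniusTrace_e5077_7]; norm_num

/-- `#Ẽ(𝔽_11) = 18` for 5077a1 (kernel point count via the Euler criterion). [folklore] -/
theorem card_e5077_11 :
    Nat.card ((e5077.map (Int.castRingHom (ZMod 11))).toAffine.Point) = 18 := by
  rw [@WeierstrassCurve.natCard_point_eq_one_add_card (ZMod 11) (@ZMod.instField 11 ⟨by norm_num⟩) _ _
    _ (by decide +kernel), @card_sol_eq_sum_euler (ZMod 11) (@ZMod.instField 11 ⟨by norm_num⟩) _ _
    (by rw [ZMod.ringChar_zmod_n]; decide), ZMod.card]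
  decide +kernel

/-- `a_11(5077a1) = −6`. [folklore] -/
theorem frobeniusTrace_e5077_11 : frobeniusTrace (e5077.baseChange ℚ) 11 = -6 := by
  rw [frobeniusTrace_baseChange_int _ card_e5077_11]
  norm_num

/-- `11` is a good ORDINARY prime of 5077a1 (`11 ∤ Δ = 5077`, `a_11 = −6`). [folklore] -/
theorem isOrdinaryAt_e5077_11 : IsOrdinaryAt (e5077.baseChange ℚ) 11 := by
  refine ⟨hasGoodReductionAtPrime_baseChange_int _ 11 ?_, ?_⟩
  · rw [e5077_Δ]; norm_num
  · rw [frobeniusTrace_e5077_11]; norm_num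

/-- `#Ẽ(𝔽_13) = 18` for 5077a1 (kernel point count via the Euler criterion). [folklore] -/
theorem card_e5077_13 :
    Nat.card ((e5077.map (Int.castRingHom (ZMod 13))).toAffine.Point) = 18 := by
  rw [@WeierstrassCurve.natCard_point_eq_one_add_card (ZMod 13) (@ZMod.instField 13 ⟨by norm_num⟩) _ _
    _ (by decide +kernel), @card_sol_eq_sum_euler (ZMod 13) (@ZMod.instField 13 ⟨by norm_num⟩) _ _
    (by rw [ZMod.ringChar_zmod_n]; decide), ZMod.card]
  decide +kernel

/-- `a_13(5077a1) = −4`. [folklore] -/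
theorem frobeniusTrace_e5077_13 : frobeniusTrace (e5077.baseChange ℚ) 13 = -4 := by
  rw [frobeniusTrace_baseChange_int _ card_e5077_13]
  norm_num

/-- `13` is a good ORDINARY prime of 5077a1 (`13 ∤ Δ = 5077`, `a_13 = −4`). [folklore] -/
theorem isOrdinaryAt_e5077_13 : IsOrdinaryAt (e5077.baseChange ℚ) 13 := by
  refine ⟨hasGoodReductionAtPrime_baseChange_int _ 13 ?_, ?_⟩
  · rw [e5077_Δ]; norm_num
  · rw [frobeniusTrace_e5077_13]; norm_num

/-- **The cells `(5077a1, p)`, `p ∈ {5, 7, 11, 13}`, of the Schneider / `p`-adic BSD census, in the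
kernel — generic in the good ordinary prime `p ≥ 5`** (per-curve certified theorem; no claim on BSD
in rank ≥ 2). Inputs named: `hPRS` (Perrin-Riou–Schneider, BMS Thm. 1.7), `hkato` (Kato Thm. 17.4 at
`(5077a1, p, f)`), `hf` (the newform of 5077a1), `hlow : 3 ≤ rank` (cert-2 two-engine certificate: three independent points — `Rank2Observatory5077a1.lean`),
`hLp : [T³] L_p(f, α_p, T) ≠ 0` (padic-1/padic-2 two-engine cell certificate; or use
`padicRow_of_riemannSum_certificate`). Ordinarity at `p = 5, 7, 11, 13`
(`isOrdinaryAt_e5077_5/7/11/13`), minimality and ellipticity are PROVED. The census cells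
(`DIFF_R3A.tsv`, all `certified(H+L)`, `v_p(Reg_MST) = 0` both engines):
* `p = 5`: `a_5 = -4`, A: level 5, `[T³]` 4/4 digits vs engine B; `Ш_5 ≡ 1`;
* `p = 7`: `a_7 = -4`, A: level 4 (`[T³] L_7 ≡ 2 + 4·7 + 4·7² (mod 7³)`), B: `nL = 7`, 3/3 digits; `Ш_7 ≡ 1`; jobs `j064033`/`j064125`, `j064694`;
* `p = 11`: `a_11 = -6`, A: level 4, `[T³]` 3/3; `Ш_11 ≡ 1`;
* `p = 13`: `a_13 = -4`, A: level 4, `[T³]` 3/3; `Ш_13 ≡ 1`;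
Output: `rank = 3`, `ord_{T=0} L_p = 3`, `Ш(5077a1)[p^∞]` finite, the canonical `p`-adic height of
5077a1 is non-degenerate, `corank Sel_{p^∞} = 3`. [cite: BalakrishnanMullerStein2015, Thm. 1.7]
[cite: Kato2004Asterisque, Thm. 17.4 (p. 273)] -/
theorem padicRow_5077a1 (p : ℕ) [Fact p.Prime] (h5 : 5 ≤ p)
    (hord : IsOrdinaryAt (e5077.baseChange ℚ) p) (hPRS : Schneider1985_order_charGenerator) {N : ℕ} [NeZero N] {f : CuspForm (Gamma0 N) 2}
    (hf : IsNewformOf (e5077.baseChange ℚ) f)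
    (hkato : ∀ (κ : ZpExtension ℚ p) (γ : Field.absoluteGaloisGroup ℚ),
      kato_divisibility (e5077.baseChange ℚ) p (κ := κ) (γ := γ) (f := f))
    (hlow : 3 ≤ curve5077a1.mordellWeilRank)
    (hLp : PowerSeries.coeff 3 (padicLFunction f (unitRoot (e5077.baseChange ℚ) p : ℚ_[p])) ≠ 0) :
    curve5077a1.mordellWeilRank = 3 ∧
      (padicLFunction f (unitRoot (e5077.baseChange ℚ) p : ℚ_[p])).order = 3 ∧
      Finite (AddCommGroup.primaryComponent (e5077.baseChange ℚ).sha p) ∧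
      (∀ Dh : PAdicHeightData (e5077.baseChange ℚ) p, Dh.IsCanonical → SchneiderConjecture Dh) ∧
      (e5077.baseChange ℚ).selmerCorank p = 3 := by
  have hlow' : 3 ≤ (e5077.baseChange ℚ).mordellWeilRank := by rw [baseChange_e5077_eq]; exact hlow
  obtain ⟨hr, ho, hfin, hS⟩ :=
    padicRow_of_certificate hPRS (e5077.baseChange ℚ) p hkato h5 hord hf hlow' hLp
  refine ⟨by rw [← baseChange_e5077_eq]; exact hr, ho, hfin, hS, ?_⟩
  exact selmerCorank_eq_of_certificate hPRS (e5077.baseChange ℚ) p hkato h5 hord hf hlow' hLp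

/-- The showcase cell `(5077a1, p = 7)` (`padicRow_5077a1` at `p = 7`, ordinarity discharged by
`isOrdinaryAt_e5077_7`). [cite: BalakrishnanMullerStein2015, Thm. 1.7]
[cite: Kato2004Asterisque, Thm. 17.4 (p. 273)] -/
theorem padicRow_5077a1_7 (hPRS : Schneider1985_order_charGenerator) {N : ℕ} [NeZero N]
    {f : CuspForm (Gamma0 N) 2} (hf : IsNewformOf (e5077.baseChange ℚ) f)
    (hkato : ∀ (κ : ZpExtension ℚ 7) (γ : Field.absoluteGaloisGroup ℚ),
      kato_divisibility (e5077.baseChange ℚ) 7 (κ := κ) (γ := γ) (f := f))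
    (hlow : 3 ≤ curve5077a1.mordellWeilRank)
    (hLp : PowerSeries.coeff 3 (padicLFunction f (unitRoot (e5077.baseChange ℚ) 7 : ℚ_[7])) ≠ 0) :
    curve5077a1.mordellWeilRank = 3 ∧
      (padicLFunction f (unitRoot (e5077.baseChange ℚ) 7 : ℚ_[7])).order = 3 ∧
      Finite (AddCommGroup.primaryComponent (e5077.baseChange ℚ).sha 7) ∧
      (∀ Dh : PAdicHeightData (e5077.baseChange ℚ) 7, Dh.IsCanonical → SchneiderConjecture Dh) ∧
      (e5077.baseChange ℚ).selmerCorank 7 = 3 :=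
  padicRow_5077a1 7 (by norm_num) isOrdinaryAt_e5077_7 hPRS hf hkato hlow hLp

end Cell5077a1

end Summit.BirchSwinnertonDyer.BirchSwinnertonDyer.Rank2Observatory

end
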